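import Mathlib
import Summits.RiemannHypothesis.RiemannHypothesis.Theorems.IntegerScrewWindowLawUniform
import HarnessLib

/-!
# Route `IntegerScrew` — the `√(log R·log log R)` form of the window law (CONTINUUM-LIMIT §27.3, the bound
# COROLLARY 27.4 sums over p)

THEOREM A/B give `WF² ≤ C₁(log R/ℓ)²·D` and the uniform laws give `WF² ≤ C₂·G(R)·D`; the geometric mean of the two
is `WF² ≤ √(C₁C₂)·(log R/ℓ)·√G(R)·D`, and multiplying by the bottom mass `H_Q ≤ 1 + ℓ ≤ 2ℓ`:

* **`window_law_sqrt`** — `148 ≤ Q`, `2Q ≤ R`: `H_Q·WF² ≤ 2√(210000·2000e²⁰)·log R·√G(R)·D_{Ω_R}(g)`;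
* **`atom_window_law_sqrt`** — `299 ≤ p`, `298p ≤ R < p²`: `H_Q·WF² ≤ 2√(3·10⁷·2000e²⁰)·log R·√G(R)·D_𝒜(g)`,

`G(R) = log R + log 4 + e⁵log(R+1)(log log R + 4) ≤ (3 + 2e⁵(log log R + 4))·log R`.  In κ-units
(κ ≤ (H_Q log R/H_R²)·WF²/D, H_R ≥ log R): **κ ≤ C·√G(R) = O((log R·log log R)^{1/2}) uniformly** — 27.3's uniform
bound, the quantity summed against `1/(p log p)`-type weights in COROLLARY 27.4.  RH-free, elementary.
Nothing in this file bears on the truth of RH.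
References: CONTINUUM-LIMIT §26–27 (rh-explicit A6-PIVOT); M. Suzuki, J. Lond. Math. Soc. (2) 108 (2023) 1448–1487
[Suzuki2023] for the screw matrices this serves.
-/

noncomputable section

set_option linter.dupNamespace false -- D-0017: `Summit.<S>.<S>.…` is the designed namespace

namespace Summit.RiemannHypothesis.RiemannHypothesis.Theorems.IntegerScrew

open Finset Real
open ArithmeticFunction (vonMangoldt)

/-- Geometric mean of two bounds: `x ≤ a·u`, `x ≤ b·v` with everything nonnegative gives `x ≤ √(ab)·√(uv)`… in the
form used here: `x ≤ A`, `x ≤ B`, `0 ≤ x` ⇒ `x ≤ √A·√B`. -/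
theorem le_sqrt_mul_sqrt_of_le_of_le {x A B : ℝ} (hx : 0 ≤ x) (hA : x ≤ A) (hB : x ≤ B) :
    x ≤ Real.sqrt A * Real.sqrt B := by
  have hA0 : 0 ≤ A := hx.trans hA
  have hB0 : 0 ≤ B := hx.trans hB
  have h : x ^ 2 ≤ A * B := by nlinarith
  have : x = Real.sqrt (x ^ 2) := by rw [Real.sqrt_sq hx]
  rw [this, ← Real.sqrt_mul hA0]
  exact Real.sqrt_le_sqrt h

/-- **The √ form on `Ω_R`.**  For `148 ≤ Q`, `2Q ≤ R`, all `g`: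
`H_Q·WF² ≤ 2·√210000·√(2000e²⁰)·log R·√G(R)·D_{Ω_R}(g)`. -/
theorem window_law_sqrt {Q R : ℕ} (hQ : 148 ≤ Q) (hQR : 2 * Q ≤ R) (g : ℕ → ℝ) :
    (∑ b ∈ Icc 1 Q, 1 / (b : ℝ)) *
        (∑ x ∈ Ioc Q R, g x / x - exitMassRatio R Q * ∑ b ∈ Icc 1 Q, g b / b) ^ 2 ≤
      2 * (Real.sqrt 210000 * Real.sqrt (2000 * Real.exp 20)) * Real.log R *
          Real.sqrt (Real.log R + Real.log 4 + Real.exp 5 * Real.log ((R : ℝ) + 1) * (Real.log (Real.log R) + 4)) *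
        ∑ x ∈ Icc 1 R, (1 / (x : ℝ)) * ∑ n ∈ x.divisors, (vonMangoldt n : ℝ) * (g x - g (x / n)) ^ 2 := by
  set G := Real.log R + Real.log 4 + Real.exp 5 * Real.log ((R : ℝ) + 1) * (Real.log (Real.log R) + 4) with hG
  set D := ∑ x ∈ Icc 1 R, (1 / (x : ℝ)) * ∑ n ∈ x.divisors, (vonMangoldt n : ℝ) * (g x - g (x / n)) ^ 2 with hD
  set W2 := (∑ x ∈ Ioc Q R, g x / x - exitMassRatio R Q * ∑ b ∈ Icc 1 Q, g b / b) ^ 2 with hW2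
  set HQ := ∑ b ∈ Icc 1 Q, 1 / (b : ℝ) with hHQ
  set ℓ := Real.log Q with hℓ
  set L := Real.log R with hL
  have hR2 : 2 ≤ R := by omega
  have hQ2 : (148 : ℝ) ≤ Q := by exact_mod_cast hQ
  have hD0 : 0 ≤ D := Finset.sum_nonneg fun x _ => mul_nonneg (by positivity)
    (Finset.sum_nonneg fun n _ => mul_nonneg ArithmeticFunction.vonMangoldt_nonneg (sq_nonneg _))
  have hW0 : 0 ≤ W2 := sq_nonneg _
  have hG0 : 0 ≤ G := (mul_nonneg_iff_of_pos_left (Real.exp_pos 10)).1 (EK_nonneg hR2)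
  have hℓ1 : 1 ≤ ℓ := by
    rw [hℓ, ← Real.log_exp 1]
    exact Real.log_le_log (Real.exp_pos 1) (by have := Real.exp_one_lt_d9; linarith)
  have hL0 : 0 ≤ L := Real.log_natCast_nonneg R
  -- the two laws
  have hA : W2 ≤ 210000 * (L / ℓ) ^ 2 * D := theoremA hQ hQR g
  have hU : W2 ≤ 2000 * Real.exp 20 * G * D := window_law_loglog hQ hQR g
  -- geometric mean
  have hgm := le_sqrt_mul_sqrt_of_le_of_le hW0 hA hU
  have hs1 : Real.sqrt (210000 * (L / ℓ) ^ 2 * D) = Real.sqrt 210000 * (L / ℓ) * Real.sqrt D := by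
    rw [Real.sqrt_mul (by positivity), Real.sqrt_mul (by norm_num), Real.sqrt_sq (by positivity)]
  have hs2 : Real.sqrt (2000 * Real.exp 20 * G * D) = Real.sqrt (2000 * Real.exp 20) * Real.sqrt G * Real.sqrt D := by
    rw [Real.sqrt_mul (by positivity), Real.sqrt_mul (by positivity)]
  rw [hs1, hs2] at hgm
  have hDD : Real.sqrt D * Real.sqrt D = D := Real.mul_self_sqrt hD0
  have hW2le : W2 ≤ Real.sqrt 210000 * Real.sqrt (2000 * Real.exp 20) * (L / ℓ) * Real.sqrt G * D := by
    calc W2 ≤ Real.sqrt 210000 * (L / ℓ) * Real.sqrt D * (Real.sqrt (2000 * Real.exp 20) * Real.sqrt G * Real.sqrt D) := hgm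
      _ = Real.sqrt 210000 * Real.sqrt (2000 * Real.exp 20) * (L / ℓ) * Real.sqrt G * (Real.sqrt D * Real.sqrt D) := by
          ring
      _ = _ := by rw [hDD]
  -- H_Q ≤ 1 + ℓ ≤ 2ℓ
  have hHQle : HQ ≤ 1 + ℓ := harmonic_Icc_le_one_add_log (R := Q) (by omega)
  have hHQ0 : 0 ≤ HQ := Finset.sum_nonneg fun b _ => by positivity
  have hHQ2 : HQ ≤ 2 * ℓ := by linarith
  have hK0 : 0 ≤ Real.sqrt 210000 * Real.sqrt (2000 * Real.exp 20) * Real.sqrt G * D := by positivity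
  calc HQ * W2 ≤ (2 * ℓ) * (Real.sqrt 210000 * Real.sqrt (2000 * Real.exp 20) * (L / ℓ) * Real.sqrt G * D) :=
        mul_le_mul hHQ2 hW2le hW0 (by linarith)
    _ = 2 * (Real.sqrt 210000 * Real.sqrt (2000 * Real.exp 20)) * L * Real.sqrt G * D := by
        field_simp
    _ = _ := by ring

/-- **The √ form on the near-extreme cells.**  For `299 ≤ p`, `298p ≤ R < p²`, all `g`:
`H_{R/p}·WF² ≤ 2·√(3·10⁷)·√(2000e²⁰)·log R·√G(R)·D_{𝒜(p⁻,R)}(g)` (WF as in `theoremB`). -/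
theorem atom_window_law_sqrt {R p : ℕ} (hp : 299 ≤ p) (hpR : 298 * p ≤ R) (hR : R < p ^ 2) (g : ℕ → ℝ) :
    (∑ b ∈ Icc 1 (R / p), 1 / (b : ℝ)) *
        (∑ x ∈ (Ioc (R / p) R).filter (· ∈ Nat.smoothNumbers p), g x / x -
          exitMassRatioAtom R (R / p) p *
            ∑ b ∈ (Icc 1 (R / p)).filter (· ∈ Nat.smoothNumbers p), g b / b) ^ 2 ≤
      2 * (Real.sqrt 30000000 * Real.sqrt (2000 * Real.exp 20)) * Real.log R *
          Real.sqrt (Real.log R + Real.log 4 + Real.exp 5 * Real.log ((R : ℝ) + 1) * (Real.log (Real.log R) + 4)) *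
        ∑ x ∈ (Icc 1 R).filter (· ∈ Nat.smoothNumbers p),
          (1 / (x : ℝ)) * ∑ n ∈ x.divisors, (vonMangoldt n : ℝ) * (g x - g (x / n)) ^ 2 := by
  set G := Real.log R + Real.log 4 + Real.exp 5 * Real.log ((R : ℝ) + 1) * (Real.log (Real.log R) + 4) with hG
  set D := ∑ x ∈ (Icc 1 R).filter (· ∈ Nat.smoothNumbers p),
    (1 / (x : ℝ)) * ∑ n ∈ x.divisors, (vonMangoldt n : ℝ) * (g x - g (x / n)) ^ 2 with hD
  set W2 := (∑ x ∈ (Ioc (R / p) R).filter (· ∈ Nat.smoothNumbers p), g x / x -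
    exitMassRatioAtom R (R / p) p * ∑ b ∈ (Icc 1 (R / p)).filter (· ∈ Nat.smoothNumbers p), g b / b) ^ 2 with hW2
  set HQ := ∑ b ∈ Icc 1 (R / p), 1 / (b : ℝ) with hHQ
  set ℓ := Real.log ((R / p : ℕ) : ℝ) with hℓ
  set L := Real.log R with hL
  have hppos : 0 < p := by omega
  have hQ : 298 ≤ R / p := (Nat.le_div_iff_mul_le hppos).2 (by linarith)
  have hR2 : 2 ≤ R := by omega
  have hQr : (298 : ℝ) ≤ ((R / p : ℕ) : ℝ) := by exact_mod_cast hQ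
  have hD0 : 0 ≤ D := Finset.sum_nonneg fun x _ => mul_nonneg (by positivity)
    (Finset.sum_nonneg fun n _ => mul_nonneg ArithmeticFunction.vonMangoldt_nonneg (sq_nonneg _))
  have hW0 : 0 ≤ W2 := sq_nonneg _
  have hG0 : 0 ≤ G := (mul_nonneg_iff_of_pos_left (Real.exp_pos 10)).1 (EK_nonneg hR2)
  have hℓ1 : 1 ≤ ℓ := by
    rw [hℓ, ← Real.log_exp 1]
    exact Real.log_le_log (Real.exp_pos 1) (by have := Real.exp_one_lt_d9; linarith)
  have hL0 : 0 ≤ L := Real.log_natCast_nonneg R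
  have hA : W2 ≤ 30000000 * (L / ℓ) ^ 2 * D := theoremB hp hpR hR g
  have hU : W2 ≤ 2000 * Real.exp 20 * G * D := near_extreme_window_law hp hpR hR g
  have hgm := le_sqrt_mul_sqrt_of_le_of_le hW0 hA hU
  have hs1 : Real.sqrt (30000000 * (L / ℓ) ^ 2 * D) = Real.sqrt 30000000 * (L / ℓ) * Real.sqrt D := by
    rw [Real.sqrt_mul (by positivity), Real.sqrt_mul (by norm_num), Real.sqrt_sq (by positivity)]
  have hs2 : Real.sqrt (2000 * Real.exp 20 * G * D) = Real.sqrt (2000 * Real.exp 20) * Real.sqrt G * Real.sqrt D := by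
    rw [Real.sqrt_mul (by positivity), Real.sqrt_mul (by positivity)]
  rw [hs1, hs2] at hgm
  have hDD : Real.sqrt D * Real.sqrt D = D := Real.mul_self_sqrt hD0
  have hW2le : W2 ≤ Real.sqrt 30000000 * Real.sqrt (2000 * Real.exp 20) * (L / ℓ) * Real.sqrt G * D := by
    calc W2 ≤ Real.sqrt 30000000 * (L / ℓ) * Real.sqrt D * (Real.sqrt (2000 * Real.exp 20) * Real.sqrt G * Real.sqrt D) := hgm
      _ = Real.sqrt 30000000 * Real.sqrt (2000 * Real.exp 20) * (L / ℓ) * Real.sqrt G * (Real.sqrt D * Real.sqrt D) := by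
          ring
      _ = _ := by rw [hDD]
  have hHQle : HQ ≤ 1 + ℓ := harmonic_Icc_le_one_add_log (R := R / p) (by omega)
  have hHQ2 : HQ ≤ 2 * ℓ := by linarith
  calc HQ * W2 ≤ (2 * ℓ) * (Real.sqrt 30000000 * Real.sqrt (2000 * Real.exp 20) * (L / ℓ) * Real.sqrt G * D) :=
        mul_le_mul hHQ2 hW2le hW0 (by linarith)
    _ = 2 * (Real.sqrt 30000000 * Real.sqrt (2000 * Real.exp 20)) * L * Real.sqrt G * D := by
        field_simp
    _ = _ := by ring

end Summit.RiemannHypothesis.RiemannHypothesis.Theorems.IntegerScrew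

end
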